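import Literature.IUT.HodgeArakelov.BadPrimeGaussianMonoidsCohomologyModelProofs2
import Literature.IUT.HodgeArakelov.ThetaEnvDataRecordBridge

/-!
# [IUTchII] Cor 3.5 (ii) "⥤" at the PRODUCED record `ThetaEnvData.toRecord` (junction J1): the hypothesis
# "`θ` is a top-level class" is STRUCTURAL — every `θ ∈ θ^ι_env(M^Θ_*)` is the transport of a class of `θ(Π) ⊆ H¹(Π_Ÿ(Π), (l·Δ_Θ)(Π))`
# (proof-only sequel to `…CohomologyModelProofs2.lean` over abc-iut-w4-d019's `ThetaEnvDataRecordBridge.lean`)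

S. Mochizuki, *Inter-universal Teichmüller theory II*, kurims Dec-2020 manuscript: Prop 1.4 p. 27 ("the subset
`θ(Π) ⊆ H¹(Π_Ÿ(Π), (l·Δ_Θ)(Π))`"), Prop 1.5 (iii) p. 30 ("`θ_env(M^Θ_*)` … by transporting `θ(Π)` via the above cyclotomic
rigidity isomorphism"), Prop 3.1 (i) p. 87, Cor 3.5 (ii) p. 95 [cite: Mochizuki2012, Cor 3.5 (ii) p.95]. Claim key
DISPUTED (D-0012). PROOF-ONLY companion (abc-iut cell, layer L6, seat abc-iut-w4-d004 gen 2; node **IUTchII:Cor3.5(ii)**,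
Galois clause; sub-DAG rows Cor-35.ii.r10 and P31.i.r2 = junction J1 of `plan/L6/SUBDAG-IUTchII-Prop-31-33-34.md`).
NO definition, NO `Prop` fact.

`…CohomologyModelProofs2.lean` discharged the junction hypotheses `hr`, `hfix`, `hs` of the Galois clause at the
cohomology model, leaving identification DATA and the hypothesis (e) "`θ` is a TOP-LEVEL class of
`lim_K H¹(Π_Ÿ|_K, −)`". For the record PRODUCED by abc-iut-w4-d019's bridge `T.toRecord act κ iota` (J1: `H := lim_J H¹`
multiplicatively, `conj := act`, `Ψ_cns := κ(M_TM)`, `θ^ι_env :=` transport along the cyclotomic rigidity isomorphism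
`transportLim` of the `ι`-invariants up to torsion of `toLim ⊤ '' θ(Π)`), hypothesis (e) is STRUCTURAL:
* `exists_toLim_of_mem_toRecord_thetaEnv` — every `θ ∈ θ^ι_env` of the record is
  `ofAdd (transportLim (toLim ⊤ y))` for some `y ∈ θ(Π) ⊆ H¹(Π_Ÿ(Π), (l·Δ_Θ)(Π))` (a top-level class);
* `toRecord_topClass` — hence, for an identification `ψ` of the record's ambient module with the model limit which
  carries transported top-level classes to top-level classes (`hψtop` — at the model the cyclotomic rigidity
  isomorphism is a change of COEFFICIENTS, level by level), `ψ θ` is top-level for every `θ ∈ θ^ι_env`;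
* `topClass_of_cohEnv_top` — `hψtop` in canonical form: it suffices that `ψ` respect TOP LEVELS (`transport_compat`);
* `mrange_pi_diagonalStable'_toRecord_of_aug`, `map_pi_diagonalStable_toRecord_of_aug` — **the Galois clause for the
  produced record**, from: the two printed properties of the Kummer map `κ` (injective, `Π_X`-equivariant — J4 /
  GAP-LEDGER G-w4d019-1; `Ψ_cns = mrange κ` holds by `rfl`), the identification `(j, ψ)` of `(lim, act)` with the model
  `(h1Lim, h1LimConj)`, `hψtop`, the augmentation datum `a` (Cor 3.5 (i)), the presentation of the sections
  `j ∘ s_t = γ_t ι γ_t⁻¹` (Cor 2.4 (ii)(c)), and `θ ∈ θ^ι_env(M^Θ_*)` — NO junction hypothesis (`hr`, `hfix`, `hs`,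
  `hsync`, `hstab`, "top-level") remains.

Nothing here asserts a disputed claim or takes a side on [IUTchIII] Cor 3.12; typed ≠ proved ≠ endorsed.
-/

namespace Literature.IUT.HodgeArakelov

namespace BadPrimeGaussianMonoids

open Literature.AnabelianGeometry.EtaleTheta CohomologySystemOfContH1 TemperedThetaMonoids

universe u x

section Record

variable {S : ThetaSetting.{u}} {F : ModelFamily S} {Sys : MonoThetaProjSystem F} (T : ThetaEnvData Sys)
  (act : Sys.PiX →* MulAut (Multiplicative T.cohEnv.lim)) {M : Type u} [CommMonoid M]
  (κ : M →* Multiplicative T.cohEnv.lim) {Iota : Type u} (iota : Iota → (T.D.coh.lim ≃+ T.D.coh.lim))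

/-- **Every `θ ∈ θ^ι_env(M^Θ_*)` of the produced record is the transport of a TOP-LEVEL class**: there is
`y ∈ θ(Π) ⊆ H¹(Π_Ÿ(Π), (l·Δ_Θ)(Π))` ([IUTchII] Prop 1.4) with `θ = ofAdd (transportLim (toLim ⊤ y))` (Prop 1.5 (iii):
"by transporting `θ(Π)` via the … cyclotomic rigidity isomorphism"). [cite: Mochizuki2012, Prop 1.5 (iii) p.30] -/
theorem exists_toLim_of_mem_toRecord_thetaEnv {ι : Iota} {θ : (T.toRecord act κ iota).H}
    (hθ : θ ∈ (T.toRecord act κ iota).thetaEnv ι) :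
    ∃ y : T.D.coh.H1 ⊤, y ∈ T.D.theta ∧ θ = Multiplicative.ofAdd (T.transportLim (T.D.coh.toLim ⊤ y)) := by
  have hθ' := (ThetaEnvData.mem_thetaIotaLim_iff T (iota ι) _).mp
    ((ThetaEnvData.mem_envSet_iff T (T.thetaIotaLim (iota ι)) θ).mp hθ)
  obtain ⟨⟨y, hy, hyθ⟩, -⟩ := hθ'
  refine ⟨y, hy, ?_⟩
  rw [hyθ, AddEquiv.apply_symm_apply]
  rfl

variable {P : TopGroup.{x}} {G' : Type x} [Group G'] [TopologicalSpace G'] [IsTopologicalGroup G']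
  (φ : P →* G') (Am : Subgroup G') [Am.Normal] [IsMulCommutative Am] (N : Subgroup P)
  (ψ : Additive (T.toRecord act κ iota).H ≃+ h1Lim φ Am N ⊥)

/-- Hence, for any identification `ψ` of the record's ambient module `lim_J H¹(…, Π_μ)` with the model limit
`lim_K H¹(Π_Ÿ|_K, A)` carrying the transported top-level classes `ofAdd (transportLim (toLim ⊤ y))` to top-level
classes (`hψtop`), `ψ θ` is a top-level class for every `θ ∈ θ^ι_env(M^Θ_*)` — hypothesis (e) of
`…CohomologyModelProofs2` HOLDS STRUCTURALLY. [cite: Mochizuki2012, Prop 1.5 (iii) p.30] -/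
theorem toRecord_topClass
    (hψtop : ∀ y ∈ T.D.theta,
      ψ (Additive.ofMul (Multiplicative.ofAdd (T.transportLim (T.D.coh.toLim ⊤ y)))) ∈
        Set.range ((cohomologySystemOfContH1 φ Am N).toLim ⊤))
    {ι : Iota} {θ : (T.toRecord act κ iota).H} (hθ : θ ∈ (T.toRecord act κ iota).thetaEnv ι) :
    ψ (Additive.ofMul θ) ∈ Set.range ((cohomologySystemOfContH1 φ Am N).toLim ⊤) := by
  obtain ⟨y, hy, rfl⟩ := exists_toLim_of_mem_toRecord_thetaEnv T act κ iota hθ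
  exact hψtop y hy

/-- The hypothesis `hψtop` in CANONICAL form: by the compatibility `transport_compat` of abc-iut-L6-t1's producer datum
(the cyclotomic rigidity isomorphism is induced LEVELWISE, `cohEnv.toLim ⊤ ∘ transportH1 ⊤ = transportLim ∘ D.coh.toLim ⊤`),
it suffices that `ψ` carry the top level `cohEnv.toLim ⊤ '' H1 ⊤` of the `Π_μ`-side system into the top level of the
model system. [cite: Mochizuki2012, Prop 1.5 (iii) p.30] -/
theorem topClass_of_cohEnv_top
    (hψtop' : ∀ z : T.cohEnv.H1 ⊤,
      ψ (Additive.ofMul (Multiplicative.ofAdd (T.cohEnv.toLim ⊤ z))) ∈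
        Set.range ((cohomologySystemOfContH1 φ Am N).toLim ⊤)) :
    ∀ y ∈ T.D.theta,
      ψ (Additive.ofMul (Multiplicative.ofAdd (T.transportLim (T.D.coh.toLim ⊤ y)))) ∈
        Set.range ((cohomologySystemOfContH1 φ Am N).toLim ⊤) := fun y _ => by
  rw [← T.transport_compat]
  exact hψtop' _

end Record

/-! ### The Galois clause for the produced record -/

section Assembly

variable {S : ThetaSetting.{u}} {F : ModelFamily S} {Sys : MonoThetaProjSystem F} (T : ThetaEnvData Sys)
  (A : AbsTopMonoids S) (act : Sys.PiX →* MulAut (Multiplicative T.cohEnv.lim))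
  (κ : A.MTM T.piXClass →* Multiplicative T.cohEnv.lim) {Iota : Type u}
  (iota : Iota → (T.D.coh.lim ≃+ T.D.coh.lim)) {L : Type*}
  {P₀ P : TopGroup.{x}} {G' : Type x} [Group G'] [TopologicalSpace G'] [IsTopologicalGroup G']
  (φ : P →* G') (Am : Subgroup G') [Am.Normal] [IsMulCommutative Am] (N : Subgroup P) [N.Normal]
  (ι : P₀ →* P) (hι : Continuous ι) (hH : (⊤ : Subgroup P₀).map ι ≤ N)
  (j : Sys.PiX →* P) (ψ : Additive (T.toRecord act κ iota).H ≃+ h1Lim φ Am N ⊥) (γ : L → P)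
  (s : L → (P₀ →* Sys.PiX))

/-- **IUTchII:Cor3.5(ii)** (kurims p.95) "each `Ψ_ξ(M^Θ_*)` is equipped with a natural action by
`G_v(M^Θ_*▶)_{⟨F_l^⋇⟩}`" **for the PRODUCED record** `T.toRecord act κ iota` (J1), restrictions out of the theta monoid
`M^×_TM · θ^ℕ` (typing of record), at the cohomology model — from: `κ` injective and `Π_X`-equivariant (J4 / G-w4d019-1;
`Ψ_cns = mrange κ` by `rfl`), the identification `(j, ψ)` of `(lim_J H¹, act)` with `(h1Lim, h1LimConj)`, `hψtop`, the
augmentation `a` killing the symmetrizing elements `γ_t`, the presentation `j ∘ s_t = γ_t ι γ_t⁻¹` with `ι(Π₀) ≤ Π_Ÿ`,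
the restrictions pinned to `ι^* ∘ conj(γ_t⁻¹) ∘ ψ`, and `θ ∈ θ^ι_env(M^Θ_*)`. No junction hypothesis remains.
[cite: Mochizuki2012, Cor 3.5 (ii) p.95] -/
theorem mrange_pi_diagonalStable'_toRecord_of_aug (hinj : Function.Injective κ)
    (hequiv : ∀ (p : Sys.PiX) (m : A.MTM T.piXClass), κ (A.actMTM T.piXClass p m) = act p (κ m))
    {K : Type*} [Group K] (a : P →* K) (hΔ : ∀ p : Sys.PiX, a (j p) = 1 → p ∈ A.Delta T.piXClass)
    (hγ : ∀ t, a (γ t) = 1)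
    (hψ : ∀ (p : Sys.PiX) (y : (T.toRecord act κ iota).H),
      ψ (Additive.ofMul (act p y)) = h1LimConj φ Am N (j p) (ψ (Additive.ofMul y)))
    (hψtop : ∀ y ∈ T.D.theta,
      ψ (Additive.ofMul (Multiplicative.ofAdd (T.transportLim (T.D.coh.toLim ⊤ y)))) ∈
        Set.range ((cohomologySystemOfContH1 φ Am N).toLim ⊤))
    (hjs : ∀ t g, j (s t g) = γ t * ι g * (γ t)⁻¹) {i₀ : Iota} {θ : (T.toRecord act κ iota).H}
    (hθ : θ ∈ (T.toRecord act κ iota).thetaEnv i₀)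
    (R : L → ((T.toRecord act κ iota).H →* Multiplicative (h1Lim (φ.comp ι) Am (⊤ : Subgroup P₀) ⊥)))
    (hR : ∀ t y, Multiplicative.toAdd (R t y) =
      h1LimComap φ Am ι hι hH (h1LimConj φ Am N (γ t)⁻¹ (ψ (Additive.ofMul y)))) (t₀ : L) (g : P₀) :
    (MonoidHom.mrange (MonoidHom.pi fun t =>
        (R t).comp (splitMonoid (T.toRecord act κ iota).units (Submonoid.powers θ)).subtype)).map
        (piIso L (h1LimConjMulAut (φ.comp ι) Am ⊤ g)).toMonoidHom =
      MonoidHom.mrange (MonoidHom.pi fun t =>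
        (R t).comp (splitMonoid (T.toRecord act κ iota).units (Submonoid.powers θ)).subtype) :=
  mrange_pi_diagonalStable'_ofCohomologyModel_of_aug A T.piXClass (T.toRecord act κ iota) κ φ Am N ι hι hH j ψ γ s
    hinj (ThetaEnvData.toRecord_constantMonoid T act κ iota) (fun p m => hequiv p m) a hΔ hγ hψ hjs θ
    (toRecord_topClass T act κ iota φ Am N ψ hψtop hθ) R hR t₀ g

/-- **IUTchII:Cor3.5(ii)** (kurims p.95), the same for restrictions typed out of the ambient group (abc-iut-w4-d004
`map_pi_diagonalStable_of_kummer_of_fixed` lineage), for the produced record; sections agreeing modulo `Δ` taken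
from the augmentation datum. [cite: Mochizuki2012, Cor 3.5 (ii) p.95] -/
theorem map_pi_diagonalStable_toRecord_of_aug (hinj : Function.Injective κ)
    (hequiv : ∀ (p : Sys.PiX) (m : A.MTM T.piXClass), κ (A.actMTM T.piXClass p m) = act p (κ m))
    {K : Type*} [Group K] (a : P →* K) (hΔ : ∀ p : Sys.PiX, a (j p) = 1 → p ∈ A.Delta T.piXClass)
    (hγ : ∀ t, a (γ t) = 1)
    (hψ : ∀ (p : Sys.PiX) (y : (T.toRecord act κ iota).H),
      ψ (Additive.ofMul (act p y)) = h1LimConj φ Am N (j p) (ψ (Additive.ofMul y)))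
    (hψtop : ∀ y ∈ T.D.theta,
      ψ (Additive.ofMul (Multiplicative.ofAdd (T.transportLim (T.D.coh.toLim ⊤ y)))) ∈
        Set.range ((cohomologySystemOfContH1 φ Am N).toLim ⊤))
    (hjs : ∀ t g, j (s t g) = γ t * ι g * (γ t)⁻¹) {i₀ : Iota} {θ : (T.toRecord act κ iota).H}
    (hθ : θ ∈ (T.toRecord act κ iota).thetaEnv i₀)
    (R : L → ((T.toRecord act κ iota).H →* Multiplicative (h1Lim (φ.comp ι) Am (⊤ : Subgroup P₀) ⊥)))
    (hR : ∀ t y, Multiplicative.toAdd (R t y) =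
      h1LimComap φ Am ι hι hH (h1LimConj φ Am N (γ t)⁻¹ (ψ (Additive.ofMul y)))) (t₀ : L) (g : P₀) :
    ((splitMonoid (T.toRecord act κ iota).units (Submonoid.powers θ)).map (MonoidHom.pi R)).map
        (piIso L (h1LimConjMulAut (φ.comp ι) Am ⊤ g)).toMonoidHom =
      (splitMonoid (T.toRecord act κ iota).units (Submonoid.powers θ)).map (MonoidHom.pi R) :=
  map_pi_diagonalStable_ofCohomologyModel A T.piXClass (T.toRecord act κ iota) κ φ Am N ι hι hH j ψ γ s hinj
    (ThetaEnvData.toRecord_constantMonoid T act κ iota) (fun p m => hequiv p m)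
    (@sections_mk_eq_of_aug _ _ _ _ ι j _ γ s _ _ a (A.Delta T.piXClass) (A.Delta_normal T.piXClass) hΔ hγ hjs)
    hψ hjs θ (toRecord_topClass T act κ iota φ Am N ψ hψtop hθ) R hR t₀ g

end Assembly

end BadPrimeGaussianMonoids

end Literature.IUT.HodgeArakelov
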